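import Literature.Barriers.ValiantsHypothesis.RankLiftingBarrierProofs
import Literature.Barriers.ValiantsHypothesis.RankLiftingBarrierFormsProofs
import HarnessLib

/-!
# The rank-lifting barrier, discharged: `RankLifting_holds`

`RankLifting = GMOW2019_thm114 ∧ GMOW2019_thm116` (`RankLiftingBarrier.lean`) — Garg–Makam–
Oliveira–Wigderson's barriers for lifting tensor-rank (Thm. 1.14) and Waring-rank (Thm. 1.16)
lower bounds from degree `k` to degree `d` — is now a THEOREM of the tree:

* `GMOW2019_thm114_holds` (`RankLiftingBarrierProofs.lean`): §5.2 (`GMOW2019_thm114_of_cor123`)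
  on top of the numeric-to-symbolic transfer, Cor. 1.23 ⇐ Thm. 1.21 ⇐ Props. 3.3 and 3.4
  (`NumericToSymbolicProp33.lean`, `NumericToSymbolicProp34.lean`; the latter from
  `Literature.RingTheory.PolynomialMaps.exists_powerSeries_transfer`, Hensel's lemma in `F⟦X⟧`);
* `GMOW2019_thm116_holds` (`RankLiftingBarrierFormsProofs.lean`): §5.3 on top of Cor. 1.23; a
  second, independent route is `GMOW2019_thm116_of_thm114` (`RankLiftingBarrierForms.lean`:
  Thm. 1.16 with `B_{d,k} = 2^d k^d` from Thm. 1.14 by the polarisation lift `φ ↦ φ ∘ π`: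
  `GMOW2019_thm116_of_thm114 GMOW2019_thm114_holds : GMOW2019_thm116`).

## References

* [GargMakamOliveiraWigderson2019] A. Garg, V. Makam, R. Oliveira, A. Wigderson, *More barriers
  for rank methods, via a "numeric to symbolic" transfer*, FOCS 2019 (arXiv:1904.04299), Thms. 1.14,
  1.16, 1.21, Cor. 1.23, Props. 3.3–3.4, §5.
-/

noncomputable section

namespace Literature.Barriers.ValiantsHypothesis

/-- **The rank-lifting barrier holds** (discharge of the barrier fact `RankLifting` =
Thm. 1.14 ∧ Thm. 1.16 of [GargMakamOliveiraWigderson2019]): no `T_k`-rank method certifies tensor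
rank above `k^d · n^{⌊(k-1)d/k⌋}` (resp. Waring rank above `B_{d,k} · n^{⌊(k-1)d/k⌋}`) times its bound
on simples, over algebraically closed fields of characteristic zero.
[cite: GargMakamOliveiraWigderson2019, Thm. 1.14 and Thm. 1.16] -/
theorem RankLifting_holds : RankLifting :=
  ⟨GMOW2019_thm114_holds, GMOW2019_thm116_holds⟩

end Literature.Barriers.ValiantsHypothesis
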